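/-
Copyright (c) 2026 the pub-hodgecm-mathlib formalisation cell (harness21).  Prover seat hodgecm-mathlib-LH7-p10 (g3), req620 Track A «(D-RAM) FOUR-FRAME» squad
((β₂) road (R-36) «PURE-CELL LEDGER», the MIX-HI family (β₂ WORD #34 ∕ #36 ‹PRODBAL›): «THE RAY SCALAR IS THE GLUE PAIRING TIMES AN AFFINE FUNCTION OF p16's DIGIT»),
helper lane on h413 = stmt-HodgeConjecture-24833 (count-neutral).  2026-09-05.
-/
import Summits.HodgeConjecture.HodgeConjecture.Theorems.F0P3cDyRamConeGlueNormTransport   -- ★ (LH4-p16): `map_pairing_self_eq_of_map_eq` (`jE⟨w₀,w₀⟩ = h·x₀Θx₀∕(YΘY) + ρ(…)`); brings ★ DEFS `dualGen`, `glueUnit`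
import HarnessLib

/-!
# Crux `H413`, line LH4 «(D-RAM) FOUR-FRAME» — the (β₂) road (R-36), MIX-HI family (β₂ WORD #34 🚩 ∕ WORD #36 ‹PRODBAL›): «THE RAY SCALAR OF A CONE-CELL MEMBER IS ITS
# GLUE PAIRING TIMES AN AFFINE FUNCTION OF p16's DIGIT» — `jE e₀ · Tr_ρ(u₀) = jE⟨w₀, w₀⟩ · (μ·ρu₀ + ρμ·u₀)`, `u₀ = h·x₀Θx₀`; equivalently `e₀ = ⟨w₀,w₀⟩ · (ρμ + (μ − ρμ)·κ̂)`,
# `κ̂ = ρu₀∕Tr_ρ(u₀)` — so the PRODUCT of the glue class and the label class of a member is `ω` of an AFFINE function of ONE digit (memo `MIXHI-PRODUCT-CHARACTER.memo.v1`)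

Cell `hodgecm-mathlib` (D-0151), FLOOR 0, crux item H413 = `stmt-HodgeConjecture-24833`, route of record `HCCMUnconditional`; squads F0∕P3c∕LH4 ∕ LH7; lane
`--supports stmt-HodgeConjecture-24833 --as helper` (count-neutral; pays NO tier-0 row).  THEOREMS ONLY (no `def`, no instance, no notation, no `sorry`, default heartbeats);
★-only imports; states NO law; the MIX-HI letters, ‹PRODBAL›, (OFF), (ROW), (β₂) stay HYPOTHESES.  DATUM-FREE, LANE-FREE: ★ (C1)'s line model `(M, jE, ρ, Θ; φ, h)` with `ρ`, `Θ`
commuting involutions and `Θh = h`, a cell scalar `cc` with `ρcc = cc`, the dual generator `Y = dualGen ρ Θ α cc h x₀` (★ DEFS), the canonical plane datum `φ w₀ = Y⁻¹x₀`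
(★ `exists_coneData_of_gen`), the ray scalar letter `he₀ : jE e₀ = Tr_ρ(μ∕(cc(α − ρα)·ΘY))` (★ p863048 ∕ p863761 ∕ p864080's spelling).  NO valuation is used: pure field algebra.

WHY (β₂ sub-dealer LH4-p04 (g10) WORD #36: on a `b ≥ d` cell `X(j,b) = 0 ⟺` the PRODUCT CHARACTER `ω(r_Λ)·lab(Λ)` is balanced over the cell (‹PRODBAL›; LH7-p09 (g3)'s
«product socket» `cellDiff_eq_zero_of_flip_of_prodBalance`), and «if `r·e′` is constant·(affine in one digit) … (P) is LH4-p14's conductor sum; if CONSTANT, (P) fails»).  Here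
`r ∝ ⟨w₀,w₀⟩` (★ DEFS `glueUnit`, ★ `map_glueNorm_eq`) and `lab = ω(e′)`, `e′·t₊ ≡ e₀` (★ p863761 ∕ LABEL LAW).  With `u₀ := h·(x₀Θx₀)` (Θ-FIXED since `Θh = h`), `Y = u₀·cc(α − ρα)`
and `ΘY = u₀·Θ(cc(α − ρα))`, so BOTH `⟨w₀,w₀⟩` and `e₀` are `ρ`-traces against the SAME element `(C·u₀)⁻¹`, `C := cc(α−ρα)·Θ(cc(α−ρα))` (`ρC = C`):
`jE⟨w₀,w₀⟩ = Tr_ρ(1∕(C u₀)) = Tr_ρ(u₀)∕(C·N_ρ u₀)` and `jE e₀ = Tr_ρ(μ∕(C u₀)) = Tr_ρ(μ·ρu₀)∕(C·N_ρ u₀)`.  Dividing: `e₀ = ⟨w₀,w₀⟩·ℓ` with `jE ℓ = Tr_ρ(μ·ρu₀)∕Tr_ρ(u₀) =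
ρμ + (μ − ρμ)·κ̂`, `κ̂ := ρu₀∕Tr_ρ(u₀)` = LH4-p16's digit (`κ̂ + ρκ̂ = 1`) — an AFFINE function of `κ̂` with CELL-CONSTANT coefficients `ρμ`, `μ − ρμ`.  Consequently (memo §2, not
typed here: it needs the class currency) `ω(r_Λ)·ω(e′_Λ) = ω(−h_W)·ω([ℓ(Λ)∕t₊]_F)`: the vertex factor `ω(Tr_ρ(1∕u₀))` sits in both characters and cancels, ‹PRODBAL› is an affine
`ω`-sum over the cell's digit set (K6-0's engine), and the ω-flip `u₀ ↦ ξ·u₀` (`ρξ = ξ`) FIXES `κ̂` — which is why it flips both characters and proves nothing about their product.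
* §1 `theta_hMul_self_eq` (`Θ(h·(x₀Θx₀)) = h·(x₀Θx₀)`), `dualGen_eq_u₀_mul`, `map_dualGen_eq_u₀_mul` (`Y = u₀·(cc(α−ρα))`, `ΘY = u₀·Θ(cc(α−ρα))`), `map_normTheta_cellScalar`
  (`ρC = C`).
* §2 `map_pairing_self_eq_trace_inv_mul` — `jE⟨w₀,w₀⟩ · (C·(u₀·ρu₀)) = u₀ + ρu₀`;  `rayScalar_mul_eq` — `jE e₀ · (C·(u₀·ρu₀)) = μ·ρu₀ + ρμ·u₀` (both from the trace shape, `u₀ ≠ 0`).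
* §3 HEAD `rayScalar_mul_trace_eq_pairing_mul` — **`jE e₀ · (u₀ + ρu₀) = jE⟨w₀,w₀⟩ · (μ·ρu₀ + ρμ·u₀)`** (division-free); HEAD′ `rayScalar_eq_pairing_mul_affine` — for
  `Tr_ρ u₀ ≠ 0`, **`jE e₀ = jE⟨w₀,w₀⟩ · (ρμ + (μ − ρμ)·(ρu₀∕(u₀ + ρu₀)))`**.
* §4 the digit under the two involutions: `kappaHat_smul_eq` (`ρξ = ξ`, `ξ ≠ 0` ⇒ `κ̂(ξu₀) = κ̂(u₀)`), `kappaHat_rhoPartner_eq` (`κ̂(−ρu₀) = 1 − κ̂(u₀)` for `Tr_ρ u₀ ≠ 0` — the ρ-partner),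
  `map_affine_eq_self` (`ρ(ρμ + (μ − ρμ)κ̂) = ρμ + (μ − ρμ)κ̂` when `κ̂ + ρκ̂ = 1`), `kappaHat_add_map` (`κ̂ + ρκ̂ = 1`).
HONEST LABEL.  Count-neutral field algebra; nothing printed is asserted; no census law is stated; ‹PRODBAL›, the MIX-HI letters, (OFF), (ROW), (β₂) stay HYPOTHESES (β₂ UNPROVED);
`HC_CM` is proved only modulo the 7 printed citations (2 remaining named inputs: hLiu418 = `stmt-HodgeConjecture-24832`, h413 = `stmt-HodgeConjecture-24833`) until rung 0 closes.
## References
* [Jacobowitz1962] R. Jacobowitz, *Hermitian forms over local fields*, Amer. J. Math. 84 (1962): §4 (dual generator, gluing datum).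
* [Serre1979] J.-P. Serre, *Local Fields*, GTM 67 (1979): Ch. III §3 (trace form), Ch. V §3 Cor. 3, Ch. XIV §3 (local symbols as characters).
* [Kottwitz1986BaseChangeUnits] R. E. Kottwitz, *Base change for unit elements of Hecke algebras*, Compositio Math. 60 (1986): §1 pp. 240–241.
* [LanglandsShelstad1987] R. P. Langlands, D. Shelstad, *On the definition of transfer factors*, Math. Ann. 278 (1987): §2 (the χ-data characters).
-/

set_option autoImplicit false

noncomputable section

namespace Summit.HodgeConjecture.HodgeConjecture.Cruxes.H413.F0P3cDyRamRayScalarGluePairing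

open Literature.NumberTheory.Automorphic Literature.NumberTheory.Automorphic.HermitianLattice Literature.NumberTheory.Automorphic.UnitaryLatticeTree
open Summit.HodgeConjecture.HodgeConjecture.Cruxes.H413.F0P3cDyRamToricCensusDefs
open Summit.HodgeConjecture.HodgeConjecture.Cruxes.H413.F0P3cDyRamConeLevelTransport (map_pairing_self_eq_of_map_eq)

variable {E M : Type*} [Field E] [Field M] {ρ Θ : M →+* M} {α : M}

/-! ## §1 The Θ-fixed scalar `u₀ = h·(x₀Θx₀)` and the cell constant `C = N_Θ(cc(α − ρα))` -/

/-- `u₀ = h·(x₀Θx₀)` is Θ-fixed when `Θ` is an involution fixing `h`. [cite: Jacobowitz1962, §4] -/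
theorem theta_hMul_self_eq (hΘΘ : ∀ x, Θ (Θ x) = x) {h : M} (hΘh : Θ h = h) (x₀ : M) : Θ (h * (x₀ * Θ x₀)) = h * (x₀ * Θ x₀) := by
  rw [map_mul, map_mul, hΘh, hΘΘ, mul_comm (Θ x₀) x₀]

/-- `Y = dualGen ρ Θ α cc h x₀ = u₀·(cc(α − ρα))`, `u₀ = h·(x₀Θx₀)` (★ DEFS, re-bracketed). [cite: Jacobowitz1962, §4] -/
theorem dualGen_eq_u₀_mul (cc h x₀ : M) : dualGen ρ Θ α cc h x₀ = h * (x₀ * Θ x₀) * (cc * (α - ρ α)) := dualGen_def ρ Θ α cc h x₀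

/-- `ΘY = u₀·Θ(cc(α − ρα))`. [cite: Jacobowitz1962, §4] -/
theorem map_dualGen_eq_u₀_mul (hΘΘ : ∀ x, Θ (Θ x) = x) {h : M} (hΘh : Θ h = h) (cc x₀ : M) :
    Θ (dualGen ρ Θ α cc h x₀) = h * (x₀ * Θ x₀) * Θ (cc * (α - ρ α)) := by
  rw [dualGen_def, map_mul Θ (h * (x₀ * Θ x₀)), theta_hMul_self_eq hΘΘ hΘh]

/-- The cell constant `C = cc(α − ρα)·Θ(cc(α − ρα))` is `ρ`-FIXED (`ρcc = cc`, `ρ(α − ρα) = −(α − ρα)`, `Θρ = ρΘ`). [cite: Serre1979, Ch. III §3] -/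
theorem map_normTheta_cellScalar (hρρ : ∀ x, ρ (ρ x) = x) (hΘρ : ∀ x, Θ (ρ x) = ρ (Θ x)) {cc : M} (hc : ρ cc = cc) :
    ρ (cc * (α - ρ α) * Θ (cc * (α - ρ α))) = cc * (α - ρ α) * Θ (cc * (α - ρ α)) := by
  have hδ : ρ (cc * (α - ρ α)) = -(cc * (α - ρ α)) := by rw [map_mul, hc, map_sub, hρρ]; ring
  rw [map_mul, ← hΘρ, hδ, map_neg]; ring

/-! ## §2 Both the glue pairing and the ray scalar are `ρ`-traces against `(C·u₀)⁻¹` -/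

/-- **THE GLUE PAIRING AS A TRACE**: with `φ w₀ = Y⁻¹x₀`, `jE⟨w₀,w₀⟩ · (C·(u₀·ρu₀)) = u₀ + ρu₀` (`h, x₀, cc, α − ρα ≠ 0`). [cite: Jacobowitz1962, §4] -/
theorem map_pairing_self_eq_trace_inv_mul (hρρ : ∀ x, ρ (ρ x) = x) (hΘΘ : ∀ x, Θ (Θ x) = x) (hΘρ : ∀ x, Θ (ρ x) = ρ (Θ x))
    (σ : E →+* E) (H₂ : Matrix (Fin 2) (Fin 2) E) (jE : E →+* M) (φ : (Fin 2 → E) →+ M) {h : M} (hΘh : Θ h = h) (hh : h ≠ 0)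
    (hform : ∀ x y, jE (pairing σ H₂ x y) = h * Θ (φ x) * φ y + ρ (h * Θ (φ x) * φ y))
    {cc x₀ : M} (hc : ρ cc = cc) (hc0 : cc ≠ 0) (hα : ρ α ≠ α) (hx₀ : x₀ ≠ 0) {w₀ : Fin 2 → E} (hw₀ : φ w₀ = (dualGen ρ Θ α cc h x₀)⁻¹ * x₀) :
    jE (pairing σ H₂ w₀ w₀) * ((cc * (α - ρ α) * Θ (cc * (α - ρ α))) * ((h * (x₀ * Θ x₀)) * ρ (h * (x₀ * Θ x₀)))) =
      h * (x₀ * Θ x₀) + ρ (h * (x₀ * Θ x₀)) := by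
  have hd : α - ρ α ≠ 0 := sub_ne_zero.2 (Ne.symm hα)
  have hΘx₀ : Θ x₀ ≠ 0 := (map_ne_zero Θ).2 hx₀
  have hu : h * (x₀ * Θ x₀) ≠ 0 := mul_ne_zero hh (mul_ne_zero hx₀ hΘx₀)
  have hρu : ρ (h * (x₀ * Θ x₀)) ≠ 0 := (map_ne_zero ρ).2 hu
  have hCδ : cc * (α - ρ α) ≠ 0 := mul_ne_zero hc0 hd
  have hΘCδ : Θ (cc * (α - ρ α)) ≠ 0 := (map_ne_zero Θ).2 hCδ
  have hC : ρ (cc * (α - ρ α) * Θ (cc * (α - ρ α))) = cc * (α - ρ α) * Θ (cc * (α - ρ α)) := map_normTheta_cellScalar hρρ hΘρ hc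
  -- `h·x₀Θx₀ ∕ (Y·ΘY) = 1 ∕ (C·u₀)`
  have hq : h * (x₀ * Θ x₀) / (dualGen ρ Θ α cc h x₀ * Θ (dualGen ρ Θ α cc h x₀)) = 1 / ((cc * (α - ρ α) * Θ (cc * (α - ρ α))) * (h * (x₀ * Θ x₀))) := by
    rw [map_dualGen_eq_u₀_mul hΘΘ hΘh, dualGen_def, div_eq_div_iff (mul_ne_zero (mul_ne_zero hu hCδ) (mul_ne_zero hu hΘCδ)) (mul_ne_zero (mul_ne_zero hCδ hΘCδ) hu)]
    ring
  rw [map_pairing_self_eq_of_map_eq σ H₂ jE φ hform hw₀, hq, map_div₀, map_one, map_mul ρ (cc * (α - ρ α) * Θ (cc * (α - ρ α))) (h * (x₀ * Θ x₀)), hC,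
    div_add_div _ _ (mul_ne_zero (mul_ne_zero hCδ hΘCδ) hu) (mul_ne_zero (mul_ne_zero hCδ hΘCδ) hρu),
    div_mul_eq_mul_div, div_eq_iff (mul_ne_zero (mul_ne_zero (mul_ne_zero hCδ hΘCδ) hu) (mul_ne_zero (mul_ne_zero hCδ hΘCδ) hρu))]
  ring

/-- **THE RAY SCALAR AS A TRACE**: `jE e₀ = Tr_ρ(μ∕(cc(α−ρα)·ΘY))` gives `jE e₀ · (C·(u₀·ρu₀)) = μ·ρu₀ + ρμ·u₀`. [cite: Jacobowitz1962, §4] [cite: Serre1979, Ch. III §3] -/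
theorem rayScalar_mul_eq (hρρ : ∀ x, ρ (ρ x) = x) (hΘΘ : ∀ x, Θ (Θ x) = x) (hΘρ : ∀ x, Θ (ρ x) = ρ (Θ x))
    {h : M} (hΘh : Θ h = h) (hh : h ≠ 0) {cc x₀ : M} (hc : ρ cc = cc) (hc0 : cc ≠ 0) (hα : ρ α ≠ α) (hx₀ : x₀ ≠ 0)
    {μ t : M} (he₀ : t = μ / (cc * (α - ρ α) * Θ (dualGen ρ Θ α cc h x₀)) + ρ (μ / (cc * (α - ρ α) * Θ (dualGen ρ Θ α cc h x₀)))) :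
    t * ((cc * (α - ρ α) * Θ (cc * (α - ρ α))) * ((h * (x₀ * Θ x₀)) * ρ (h * (x₀ * Θ x₀)))) =
      μ * ρ (h * (x₀ * Θ x₀)) + ρ μ * (h * (x₀ * Θ x₀)) := by
  have hd : α - ρ α ≠ 0 := sub_ne_zero.2 (Ne.symm hα)
  have hΘx₀ : Θ x₀ ≠ 0 := (map_ne_zero Θ).2 hx₀
  have hu : h * (x₀ * Θ x₀) ≠ 0 := mul_ne_zero hh (mul_ne_zero hx₀ hΘx₀)
  have hρu : ρ (h * (x₀ * Θ x₀)) ≠ 0 := (map_ne_zero ρ).2 hu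
  have hCδ : cc * (α - ρ α) ≠ 0 := mul_ne_zero hc0 hd
  have hΘCδ : Θ (cc * (α - ρ α)) ≠ 0 := (map_ne_zero Θ).2 hCδ
  have hC : ρ (cc * (α - ρ α) * Θ (cc * (α - ρ α))) = cc * (α - ρ α) * Θ (cc * (α - ρ α)) := map_normTheta_cellScalar hρρ hΘρ hc
  -- `μ ∕ (cc(α−ρα)·ΘY) = μ ∕ (C·u₀)`
  have hq : μ / (cc * (α - ρ α) * Θ (dualGen ρ Θ α cc h x₀)) = μ / ((cc * (α - ρ α) * Θ (cc * (α - ρ α))) * (h * (x₀ * Θ x₀))) := by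
    rw [map_dualGen_eq_u₀_mul hΘΘ hΘh]; ring
  rw [he₀, hq, map_div₀, map_mul ρ (cc * (α - ρ α) * Θ (cc * (α - ρ α))) (h * (x₀ * Θ x₀)), hC,
    div_add_div _ _ (mul_ne_zero (mul_ne_zero hCδ hΘCδ) hu) (mul_ne_zero (mul_ne_zero hCδ hΘCδ) hρu),
    div_mul_eq_mul_div, div_eq_iff (mul_ne_zero (mul_ne_zero (mul_ne_zero hCδ hΘCδ) hu) (mul_ne_zero (mul_ne_zero hCδ hΘCδ) hρu))]
  ring

/-! ## §3 HEADS: the ray scalar is the glue pairing times an affine function of `κ̂ = ρu₀∕Tr_ρ(u₀)` -/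

/-- **HEAD (division-free) — `jE e₀ · Tr_ρ(u₀) = jE⟨w₀,w₀⟩ · (μ·ρu₀ + ρμ·u₀)`**, `u₀ = h·(x₀Θx₀)`: the ray scalar of a cone-cell member and its glue pairing are `ρ`-traces of `μ∕(Cu₀)`
and `1∕(Cu₀)` (§2), whence the cross-multiplied identity (no `Tr_ρ u₀ ≠ 0` needed). [cite: Jacobowitz1962, §4] [cite: Serre1979, Ch. III §3] [cite: Kottwitz1986BaseChangeUnits, §1 pp. 240–241] -/
theorem rayScalar_mul_trace_eq_pairing_mul (hρρ : ∀ x, ρ (ρ x) = x) (hΘΘ : ∀ x, Θ (Θ x) = x) (hΘρ : ∀ x, Θ (ρ x) = ρ (Θ x))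
    (σ : E →+* E) (H₂ : Matrix (Fin 2) (Fin 2) E) (jE : E →+* M) (φ : (Fin 2 → E) →+ M) {h : M} (hΘh : Θ h = h) (hh : h ≠ 0)
    (hform : ∀ x y, jE (pairing σ H₂ x y) = h * Θ (φ x) * φ y + ρ (h * Θ (φ x) * φ y))
    {cc x₀ : M} (hc : ρ cc = cc) (hc0 : cc ≠ 0) (hα : ρ α ≠ α) (hx₀ : x₀ ≠ 0) {w₀ : Fin 2 → E} (hw₀ : φ w₀ = (dualGen ρ Θ α cc h x₀)⁻¹ * x₀)
    {μ t : M} (he₀ : t = μ / (cc * (α - ρ α) * Θ (dualGen ρ Θ α cc h x₀)) + ρ (μ / (cc * (α - ρ α) * Θ (dualGen ρ Θ α cc h x₀)))) :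
    t * (h * (x₀ * Θ x₀) + ρ (h * (x₀ * Θ x₀))) = jE (pairing σ H₂ w₀ w₀) * (μ * ρ (h * (x₀ * Θ x₀)) + ρ μ * (h * (x₀ * Θ x₀))) := by
  have hd : α - ρ α ≠ 0 := sub_ne_zero.2 (Ne.symm hα)
  have hΘx₀ : Θ x₀ ≠ 0 := (map_ne_zero Θ).2 hx₀
  have hu : h * (x₀ * Θ x₀) ≠ 0 := mul_ne_zero hh (mul_ne_zero hx₀ hΘx₀)
  have hρu : ρ (h * (x₀ * Θ x₀)) ≠ 0 := (map_ne_zero ρ).2 hu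
  have hCδ : cc * (α - ρ α) ≠ 0 := mul_ne_zero hc0 hd
  have hΘCδ : Θ (cc * (α - ρ α)) ≠ 0 := (map_ne_zero Θ).2 hCδ
  have hD : (cc * (α - ρ α) * Θ (cc * (α - ρ α))) * ((h * (x₀ * Θ x₀)) * ρ (h * (x₀ * Θ x₀))) ≠ 0 :=
    mul_ne_zero (mul_ne_zero hCδ hΘCδ) (mul_ne_zero hu hρu)
  have hP := map_pairing_self_eq_trace_inv_mul hρρ hΘΘ hΘρ σ H₂ jE φ hΘh hh hform hc hc0 hα hx₀ hw₀
  have hR := rayScalar_mul_eq hρρ hΘΘ hΘρ hΘh hh hc hc0 hα hx₀ he₀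
  -- cross-multiply the two trace identities by the common non-zero denominator
  have key : t * (h * (x₀ * Θ x₀) + ρ (h * (x₀ * Θ x₀))) * ((cc * (α - ρ α) * Θ (cc * (α - ρ α))) * ((h * (x₀ * Θ x₀)) * ρ (h * (x₀ * Θ x₀)))) =
      jE (pairing σ H₂ w₀ w₀) * (μ * ρ (h * (x₀ * Θ x₀)) + ρ μ * (h * (x₀ * Θ x₀))) *
        ((cc * (α - ρ α) * Θ (cc * (α - ρ α))) * ((h * (x₀ * Θ x₀)) * ρ (h * (x₀ * Θ x₀)))) := by
    calc t * (h * (x₀ * Θ x₀) + ρ (h * (x₀ * Θ x₀))) * ((cc * (α - ρ α) * Θ (cc * (α - ρ α))) * ((h * (x₀ * Θ x₀)) * ρ (h * (x₀ * Θ x₀))))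
        = (t * ((cc * (α - ρ α) * Θ (cc * (α - ρ α))) * ((h * (x₀ * Θ x₀)) * ρ (h * (x₀ * Θ x₀))))) * (h * (x₀ * Θ x₀) + ρ (h * (x₀ * Θ x₀))) := by ring
      _ = (μ * ρ (h * (x₀ * Θ x₀)) + ρ μ * (h * (x₀ * Θ x₀))) *
            (jE (pairing σ H₂ w₀ w₀) * ((cc * (α - ρ α) * Θ (cc * (α - ρ α))) * ((h * (x₀ * Θ x₀)) * ρ (h * (x₀ * Θ x₀))))) := by rw [hR, hP]
      _ = jE (pairing σ H₂ w₀ w₀) * (μ * ρ (h * (x₀ * Θ x₀)) + ρ μ * (h * (x₀ * Θ x₀))) *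
            ((cc * (α - ρ α) * Θ (cc * (α - ρ α))) * ((h * (x₀ * Θ x₀)) * ρ (h * (x₀ * Θ x₀)))) := by ring
  exact mul_right_cancel₀ hD key

/-- **HEAD′ — `e₀ = ⟨w₀,w₀⟩ · (ρμ + (μ − ρμ)·κ̂)`, `κ̂ = ρu₀∕(u₀ + ρu₀)`** (LH4-p16's digit; `Tr_ρ u₀ ≠ 0`): the ray scalar is the glue pairing times an AFFINE function of ONE digit with
CELL-CONSTANT coefficients `ρμ`, `μ − ρμ`. [cite: Jacobowitz1962, §4] [cite: Serre1979, Ch. III §3] [cite: LanglandsShelstad1987, §2] -/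
theorem rayScalar_eq_pairing_mul_affine (hρρ : ∀ x, ρ (ρ x) = x) (hΘΘ : ∀ x, Θ (Θ x) = x) (hΘρ : ∀ x, Θ (ρ x) = ρ (Θ x))
    (σ : E →+* E) (H₂ : Matrix (Fin 2) (Fin 2) E) (jE : E →+* M) (φ : (Fin 2 → E) →+ M) {h : M} (hΘh : Θ h = h) (hh : h ≠ 0)
    (hform : ∀ x y, jE (pairing σ H₂ x y) = h * Θ (φ x) * φ y + ρ (h * Θ (φ x) * φ y))
    {cc x₀ : M} (hc : ρ cc = cc) (hc0 : cc ≠ 0) (hα : ρ α ≠ α) (hx₀ : x₀ ≠ 0) {w₀ : Fin 2 → E} (hw₀ : φ w₀ = (dualGen ρ Θ α cc h x₀)⁻¹ * x₀)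
    {μ t : M} (he₀ : t = μ / (cc * (α - ρ α) * Θ (dualGen ρ Θ α cc h x₀)) + ρ (μ / (cc * (α - ρ α) * Θ (dualGen ρ Θ α cc h x₀))))
    (ht : h * (x₀ * Θ x₀) + ρ (h * (x₀ * Θ x₀)) ≠ 0) :
    t = jE (pairing σ H₂ w₀ w₀) * (ρ μ + (μ - ρ μ) * (ρ (h * (x₀ * Θ x₀)) / (h * (x₀ * Θ x₀) + ρ (h * (x₀ * Θ x₀))))) := by
  have key := rayScalar_mul_trace_eq_pairing_mul hρρ hΘΘ hΘρ σ H₂ jE φ hΘh hh hform hc hc0 hα hx₀ hw₀ he₀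
  have hA : μ * ρ (h * (x₀ * Θ x₀)) + ρ μ * (h * (x₀ * Θ x₀)) =
      (ρ μ + (μ - ρ μ) * (ρ (h * (x₀ * Θ x₀)) / (h * (x₀ * Θ x₀) + ρ (h * (x₀ * Θ x₀))))) * (h * (x₀ * Θ x₀) + ρ (h * (x₀ * Θ x₀))) := by
    rw [add_mul, mul_assoc, div_mul_cancel₀ _ ht]; ring
  rw [hA, ← mul_assoc (jE (pairing σ H₂ w₀ w₀))] at key
  exact mul_right_cancel₀ ht key

/-! ## §4 The digit under the two involutions of the MIX-HI family -/

/-- **THE ω-FLIP FIXES THE DIGIT**: for a `ρ`-fixed `ξ ≠ 0`, `κ̂(ξ·u₀) = κ̂(u₀)` — so a cell involution `u₀ ↦ ξu₀` (★ p860971 ∕ p863829: `x₀ ↦ εx₀`, `εΘε = jE ξ₀`) cannot move any function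
of `κ̂`; it flips the glue class and the label class separately and fixes their product. [cite: Serre1979, Ch. V §3 Cor. 3] -/
theorem kappaHat_smul_eq {ξ u₀ : M} (hξ : ρ ξ = ξ) (hξ0 : ξ ≠ 0) :
    ρ (ξ * u₀) / (ξ * u₀ + ρ (ξ * u₀)) = ρ u₀ / (u₀ + ρ u₀) := by
  rw [map_mul, hξ, ← mul_add, mul_div_mul_left _ _ hξ0]

/-- **THE ρ-PARTNER REFLECTS THE DIGIT**: `κ̂(−ρu₀) = 1 − κ̂(u₀)` (`Tr_ρ u₀ ≠ 0`) — the involution `Λ ↦ t·ρΛ` (`N_Θ t = −ρh∕h`, `u₀ ↦ −ρu₀`) acts on the digit by `κ̂ ↦ 1 − κ̂`.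
[cite: Serre1979, Ch. III §3] -/
theorem kappaHat_rhoPartner_eq (hρρ : ∀ x, ρ (ρ x) = x) {u₀ : M} (ht : u₀ + ρ u₀ ≠ 0) :
    ρ (-ρ u₀) / (-ρ u₀ + ρ (-ρ u₀)) = 1 - ρ u₀ / (u₀ + ρ u₀) := by
  rw [map_neg, hρρ, show -ρ u₀ + -u₀ = -(u₀ + ρ u₀) by ring, neg_div_neg_eq, eq_sub_iff_add_eq, ← add_div, div_self ht]

/-- The affine function `ρμ + (μ − ρμ)·κ̂` is `ρ`-FIXED whenever `κ̂ + ρκ̂ = 1` (so `ℓ(Λ) ∈ Fix ρ = jE(E)`). [cite: Serre1979, Ch. III §3] -/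
theorem map_affine_eq_self (hρρ : ∀ x, ρ (ρ x) = x) {μ κ : M} (hκ : κ + ρ κ = 1) : ρ (ρ μ + (μ - ρ μ) * κ) = ρ μ + (μ - ρ μ) * κ := by
  have hρκ : ρ κ = 1 - κ := by rw [← hκ]; ring
  rw [map_add, map_mul, map_sub, hρρ, hρκ]
  ring

/-- `κ̂ + ρκ̂ = 1` for `κ̂ = ρu₀∕(u₀ + ρu₀)`, `Tr_ρ u₀ ≠ 0`. [cite: Serre1979, Ch. III §3] -/
theorem kappaHat_add_map (hρρ : ∀ x, ρ (ρ x) = x) {u₀ : M} (ht : u₀ + ρ u₀ ≠ 0) :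
    ρ u₀ / (u₀ + ρ u₀) + ρ (ρ u₀ / (u₀ + ρ u₀)) = 1 := by
  rw [map_div₀, hρρ, map_add, hρρ, add_comm (ρ u₀) u₀, ← add_div, add_comm (ρ u₀) u₀, div_self ht]

end Summit.HodgeConjecture.HodgeConjecture.Cruxes.H413.F0P3cDyRamRayScalarGluePairing

end
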